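import Mathlib
import Literature.Probability.LatticeModels.GKSInequalities
import Summits.CriticalPhenomena.Ising3DConformalLimit.Theorems.PrecisionLaplacianInverseMFerromagnetLaw2SixFree
import Summits.CriticalPhenomena.Ising3DConformalLimit.Theorems.PrecisionLaplacianInverseMFerromagnetNim3SixOf
import HarnessLib

/-!
# Crux `PrecisionLaplacian.InverseMFerromagnet` (stmt-CriticalPhenomena-4798), line `Sketch` —
# `helper_nim3_six`: NIM₃ ON SIX SITES (a new all-couplings class of the crux)

THEOREM-ONLY file (no definitions).  For every zero-field pair ferromagnet on `Fin 6` (any multigraph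
support, all couplings `K ≥ 0`) and every pair of sites `x ≠ y` lying in no common bond, each in at most
three bonds, the precision entry `(Σ⁻¹)_{xy}` is `≤ 0` — the crux IM at these pairs (prism, `W₅` rim
pairs, `K₃,₃`, the middle pair of `K₆ − P₄`, …).  Proof: the landed implication `helper_nim3_six_of`
(p129538: C2 re-run at `n = 6` with a local `Law₂` hypothesis) applied to the landed local `Law₂`
`helper_law2_six_free` (p129726: transport of `helper_law2_four`, p129163, to `Fin 6` with two free sites).
-/

namespace Summit.CriticalPhenomena.Ising3DConformalLimit.Cruxes.InverseMFerromagnet.PartialCovarianceLadder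

open Literature.Probability.LatticeModels Finset Matrix

/-- **Registered helper `helper_nim3_six`: NIM₃ on six sites** — IM at every non-adjacent pair of
bond-degree `≤ 3` of every 6-site zero-field pair ferromagnet, all couplings.  `helper_nim3_six_of`
(p129538) applied to `helper_law2_six_free` (p129726). [folklore] -/
theorem helper_nim3_six :
    ∀ (m : ℕ) (K : Fin m → ℝ) (C : Fin m → Finset (Fin 6)), (∀ i, 0 ≤ K i) → (∀ i, (C i).card = 2) →
      ∀ x y : Fin 6, x ≠ y → (∀ i, ¬ (x ∈ C i ∧ y ∈ C i)) →
        (Finset.univ.filter (fun i => x ∈ C i)).card ≤ 3 → (Finset.univ.filter (fun i => y ∈ C i)).card ≤ 3 →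
        (Matrix.of fun p q : Fin 6 => gksExpect Finset.univ K C (fun ω => spinAt p ω * spinAt q ω))⁻¹ x y ≤ 0 :=
  helper_nim3_six_of helper_law2_six_free

end Summit.CriticalPhenomena.Ising3DConformalLimit.Cruxes.InverseMFerromagnet.PartialCovarianceLadder
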